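import Mathlib.Analysis.SpecialFunctions.Complex.LogDeriv
import Mathlib.Analysis.InnerProductSpace.Calculus
import Literature.Geometry.Kaehler.HolomorphicLineBundle
import Literature.Geometry.Kaehler.ManifoldFormsChart
import Literature.Geometry.Kaehler.KaehlerProofs
import Literature.Analysis.Complex.SeveralVariables
import HarnessLib

/-!
# `∂∂̄ log |g|² = 0`: pluriharmonicity of `log ‖g‖²` for a non-vanishing holomorphic function

Layer `Literature/Geometry/Kaehler`; support for the Chern–Weil leaf of Lefschetz's theorem on
`(1,1)`-classes (`Literature/AlgebraicGeometry/HodgeTheory/LefschetzOneOneChernWeilProofs`, the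
discharge of `chernForm_exact_of_isTrivialOn`). Voisin (2002), §3.3.1: the local Chern forms
`ω_i = (1/2iπ) ∂∂̄ log h_i` of a Hermitian holomorphic line bundle "coincide on `U_i ∩ U_j`,
since `∂∂̄ log |g_ij|² = 0`" — the transition functions `g_ij` being holomorphic and invertible.
In the tree's spelling of the Chern form (`HolomorphicLineBundle.HermitianMetric.localChernForm`:
`(1/2iπ) ∂∂̄ f = (1/4π) d((df) ∘ J)` for real `f`, with the exterior derivative `mextDeriv` of
`ManifoldForms` and the complex structure `J = tangentJ`), the statement to prove is

* `mextDeriv_compJ_mextDeriv_log_norm_sq_eq_zero`: for `g : M → ℂ` holomorphic and nowhere zero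
  on an open subset `V` of a complex manifold `M` (finite-dimensional model `E`), the `2`-form
  `d((d log ‖g‖²) ∘ J)` vanishes at every point of `V`.

Proof (Cauchy–Riemann, as in the source): near `x ∈ V` the function `G = log (g / g(x))` is a
holomorphic logarithm, `log ‖g‖² = 2 Re G + log ‖g(x)‖²`, and for a holomorphic `G` one has
`(d Re G) ∘ J = -d (Im G)` (the differential of `G` is `ℂ`-linear), so
`(d log ‖g‖²) ∘ J = d(-2 Im G)` near `x` and `d((d log ‖g‖²) ∘ J) = dd(-2 Im G) = 0` by the local
`d ∘ d = 0` of `ManifoldFormsChart`.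

On the way, the file supplies the small chart calculus this needs, all PROVED:

* `0`-forms (`MForm.ofFun` of `HolomorphicLineBundle`), for any real model with corners:
  `MForm.inChart_ofFun`, `MForm.smoothAt_ofFun_iff` / `MForm.smoothAt_ofFun_of_contMDiffAt`
  (a `C^∞` function is a smooth `0`-form), `mextDeriv_ofFun_apply` (`d` of a `0`-form is the
  differential, Mathlib's `extDerivWithin_constOfIsEmpty`);
* holomorphic ⇒ real `C^∞` ON AN OPEN SET (`contMDiffOn_real_of_mdifferentiableOn_complex`, the
  local form of `MDifferentiable.contMDiff_real_of_complex` of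
  `NumberTheory/Transcendental/ComplexFormsPullback`, via `SCV.contDiffOn_infty`);
* the complex structure in charts: `tangentCoordChange_I_smul` (holomorphic coordinate changes
  have `ℂ`-linear differentials, from `tangentCoordChange_eq_restrictScalars` of `KaehlerProofs`),
  `MForm.inChart_compJ_of_mem_target` (the representative of `α ∘ J` is the representative of `α`
  precomposed with `i • ·`), hence `MForm.SmoothAt.compJ`.

## References

* C. Voisin, *Hodge Theory and Complex Algebraic Geometry I* (CUP 2002), §2.2.1 (holomorphic
  coordinate changes), §3.3.1 (Chern form; `∂∂̄ log |g_ij|² = 0`), proof of Thm. 7.10.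
* F. W. Warner, *Foundations of Differentiable Manifolds and Lie Groups*, GTM 94 (1983), 2.15,
  2.20 (`0`-forms, `d` on functions).
-/

noncomputable section

open scoped Manifold ContDiff Topology
open Bundle Set Filter

namespace Literature.Geometry.Kaehler

/-! ### Functions as `0`-forms: chart representative, smoothness, `d` -/

section ZeroForms

variable {E : Type*} [NormedAddCommGroup E] [NormedSpace ℝ E]
  {H : Type*} [TopologicalSpace H] {I : ModelWithCorners ℝ E H}
  {M : Type*} [TopologicalSpace M] [ChartedSpace H M]
  {F : Type*} [NormedAddCommGroup F] [NormedSpace ℝ F]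

/-- The chart representative of the `0`-form of a function `f` at `x₀` is the `0`-form of
`f ∘ φ_{x₀}⁻¹` (Warner (1983), 2.18). [cite: WarnerGTM94, 2.18] -/
theorem MForm.inChart_ofFun (f : M → F) (x₀ : M) :
    (MForm.ofFun I f).inChart x₀ =
      fun y ↦ ContinuousAlternatingMap.constOfIsEmpty ℝ E (Fin 0) (f ((extChartAt I x₀).symm y)) := by
  funext y
  ext v
  rfl

/-- The `0`-form of a sum of functions is the sum of the `0`-forms. [folklore] -/
theorem MForm.ofFun_add (f g : M → F) :
    MForm.ofFun I (f + g) = MForm.ofFun I f + MForm.ofFun I g := by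
  funext x
  ext v
  rfl

/-- Smoothness of the `0`-form of `f` at `x` is `C^∞`-regularity of `f` read in the chart at `x`
(the identification of `0`-forms with functions is a linear isometry). Warner (1983), 2.15.
[cite: WarnerGTM94, 2.15] -/
theorem MForm.smoothAt_ofFun_iff (f : M → F) (x : M) :
    (MForm.ofFun I f).SmoothAt x ↔
      ContDiffWithinAt ℝ ∞ (f ∘ (extChartAt I x).symm) (range I) (extChartAt I x x) := by
  rw [MForm.SmoothAt, MForm.inChart_ofFun]
  exact (ContinuousAlternatingMap.constOfIsEmptyLIE ℝ E F (Fin 0)).toContinuousLinearEquiv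
    |>.comp_contDiffWithinAt_iff

/-- A function that is `C^∞` at `x` in the manifold sense defines a `0`-form smooth at `x`
(Warner (1983), 2.15: `E⁰(M) = C^∞(M)`). [cite: WarnerGTM94, 2.15] -/
theorem MForm.smoothAt_ofFun_of_contMDiffAt {f : M → F} {x : M}
    (hf : ContMDiffAt I 𝓘(ℝ, F) ∞ f x) : (MForm.ofFun I f).SmoothAt x := by
  rw [MForm.smoothAt_ofFun_iff]
  have h := (contMDiffAt_iff.1 hf).2
  simpa only [extChartAt_model_space_eq_id, PartialEquiv.refl_coe, Function.id_comp] using h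

variable [IsManifold I ∞ M]

/-- **`d` of a `0`-form is the differential**: `d(f) x v = D(f ∘ φₓ⁻¹)(φₓ x) v` in the chart `φₓ`
at `x` (Warner (1983), 2.20(a); Mathlib's `extDerivWithin_constOfIsEmpty` at the chart centre).
[cite: WarnerGTM94, 2.20] -/
theorem mextDeriv_ofFun_apply (f : M → F) (x : M) (v : Fin 1 → TangentSpace I x) :
    mextDeriv (MForm.ofFun I f) x v =
      fderivWithin ℝ (f ∘ (extChartAt I x).symm) (range I) (extChartAt I x x) (v 0) := by
  have hU : UniqueDiffWithinAt ℝ (range I) (extChartAt I x x) :=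
    I.uniqueDiffOn _ (mem_range_self _)
  rw [mextDeriv_eq_extDerivWithin, MForm.inChart_ofFun, extDerivWithin_constOfIsEmpty _ hU]
  rfl

end ZeroForms

/-! ### Holomorphic functions on an open subset of a complex manifold are real `C^∞` -/

section Holomorphic

variable {E : Type*} [NormedAddCommGroup E] [NormedSpace ℂ E]
  {M : Type*} [TopologicalSpace M] [ChartedSpace E M] [IsManifold 𝓘(ℂ, E) ω M]
  {F : Type*} [NormedAddCommGroup F] [NormedSpace ℂ F]

/-- A function holomorphic on an open subset `V` of a complex manifold is, read in any chart,
complex differentiable on the corresponding open subset of the chart target (Voisin (2002),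
§2.2.1: holomorphy is read in holomorphic charts). [cite: VoisinHodgeI2002, §2.2.1] -/
theorem differentiableOn_comp_extChartAt_symm_of_mdifferentiableOn {g : M → F} {V : Set M}
    (hg : MDifferentiableOn 𝓘(ℂ, E) 𝓘(ℂ, F) g V) (hV : IsOpen V) (x : M) :
    DifferentiableOn ℂ (g ∘ (extChartAt 𝓘(ℂ, E) x).symm)
      ((extChartAt 𝓘(ℂ, E) x).target ∩ (extChartAt 𝓘(ℂ, E) x).symm ⁻¹' V) := by
  intro y hy
  set z := (extChartAt 𝓘(ℂ, E) x).symm y with hz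
  have hzV : z ∈ V := hy.2
  have hzs : z ∈ (chartAt E x).source := by
    rw [← extChartAt_source 𝓘(ℂ, E)]
    exact (extChartAt 𝓘(ℂ, E) x).map_target hy.1
  have hd : MDifferentiableAt 𝓘(ℂ, E) 𝓘(ℂ, F) g z :=
    (hg z hzV).mdifferentiableAt (hV.mem_nhds hzV)
  have h2 := ((mdifferentiableAt_iff_of_mem_source (I' := 𝓘(ℂ, F)) hzs
    (mem_chart_source F (g z))).1 hd).2
  simp only [extChartAt_model_space_eq_id, PartialEquiv.refl_coe, Function.id_comp,
    ModelWithCorners.Boundaryless.range_eq_univ] at h2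
  rw [hz, (extChartAt 𝓘(ℂ, E) x).right_inv hy.1] at h2
  exact h2.mono (subset_univ _)

/-- **Holomorphic functions are real `C^∞`** on an open set (several complex variables: Cauchy
estimates on complex lines, `Literature.Analysis.Complex.SCV.contDiffOn_infty`; the local form, for
functions on an open subset with values in a complete space, of
`MDifferentiable.contMDiff_real_of_complex`). Voisin (2002), §1.2.1 (Thm. 1.17: holomorphic ⇔
analytic) and §2.2.1. [cite: VoisinHodgeI2002, §1.2.1 Thm. 1.17] -/
theorem contMDiffOn_real_of_mdifferentiableOn_complex [FiniteDimensional ℂ E] [CompleteSpace F]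
    [IsManifold 𝓘(ℝ, E) ∞ M] {g : M → F} {V : Set M} (hg : MDifferentiableOn 𝓘(ℂ, E) 𝓘(ℂ, F) g V)
    (hV : IsOpen V) : ContMDiffOn 𝓘(ℝ, E) 𝓘(ℝ, F) ∞ g V := by
  rw [contMDiffOn_iff]
  refine ⟨hg.continuousOn, fun x y ↦ ?_⟩
  simp only [extChartAt_model_space_eq_id, PartialEquiv.refl_coe, Function.id_comp,
    PartialEquiv.refl_source, preimage_univ, inter_univ]
  have hO : IsOpen ((extChartAt 𝓘(ℂ, E) x).target ∩ (extChartAt 𝓘(ℂ, E) x).symm ⁻¹' V) :=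
    (continuousOn_extChartAt_symm x).isOpen_inter_preimage (isOpen_extChartAt_target x) hV
  exact ((Literature.Analysis.Complex.SCV.contDiffOn_infty
    (differentiableOn_comp_extChartAt_symm_of_mdifferentiableOn hg hV x) hO).restrict_scalars ℝ :)

/-- Pointwise form: a function holomorphic on an open set is real `C^∞` at each of its points.
[cite: VoisinHodgeI2002, §1.2.1 Thm. 1.17] -/
theorem contMDiffAt_real_of_mdifferentiableOn_complex [FiniteDimensional ℂ E] [CompleteSpace F]
    [IsManifold 𝓘(ℝ, E) ∞ M] {g : M → F} {V : Set M} (hg : MDifferentiableOn 𝓘(ℂ, E) 𝓘(ℂ, F) g V)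
    (hV : IsOpen V) {x : M} (hx : x ∈ V) : ContMDiffAt 𝓘(ℝ, E) 𝓘(ℝ, F) ∞ g x :=
  (contMDiffOn_real_of_mdifferentiableOn_complex hg hV).contMDiffAt (hV.mem_nhds hx)

end Holomorphic

/-! ### The complex structure on `1`-forms, in charts -/

section ComplexStructure

variable {E : Type*} [NormedAddCommGroup E] [NormedSpace ℂ E]
  {M : Type*} [TopologicalSpace M] [ChartedSpace E M]
  {F : Type*} [NormedAddCommGroup F] [NormedSpace ℝ F]

/-- `α ↦ α ∘ J` is additive. [folklore] -/
theorem MForm.compJ_add (α β : MForm 𝓘(ℝ, E) M F 1) : (α + β).compJ = α.compJ + β.compJ := by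
  funext x
  ext v
  rfl

variable [IsManifold 𝓘(ℝ, E) ∞ M] [IsManifold 𝓘(ℂ, E) ω M]

/-- **Tangent coordinate changes of a complex manifold commute with `i`** (Voisin (2002), §2.2.1:
the changes of charts are holomorphic, i.e. have `ℂ`-linear differentials;
`tangentCoordChange_eq_restrictScalars`). [cite: VoisinHodgeI2002, §2.2.1] -/
theorem tangentCoordChange_I_smul {x y z : M}
    (h : z ∈ (extChartAt 𝓘(ℝ, E) x).source ∩ (extChartAt 𝓘(ℝ, E) y).source) (v : E) :
    tangentCoordChange 𝓘(ℝ, E) x y z (Complex.I • v) =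
      Complex.I • tangentCoordChange 𝓘(ℝ, E) x y z v := by
  have h' : z ∈ (extChartAt 𝓘(ℂ, E) x).source ∩ (extChartAt 𝓘(ℂ, E) y).source := by
    simp only [extChartAt_source] at h ⊢
    exact h
  rw [tangentCoordChange_eq_restrictScalars h', ContinuousLinearMap.coe_restrictScalars', map_smul]

/-- **Chart representative of `α ∘ J`.** On the target of the chart at `x₀`, the representative of
`α.compJ` is the representative of `α` precomposed with multiplication by `i` on the model space:
the derivative of the inverse chart is a tangent coordinate change (`MForm.inChart_eq_of_mem_target`),
which commutes with `i` (`tangentCoordChange_I_smul`). Voisin (2002), §2.2.1 (the local operators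
`1 × i` glue to the global `I`). [cite: VoisinHodgeI2002, §2.2.1] -/
theorem MForm.inChart_compJ_of_mem_target (α : MForm 𝓘(ℝ, E) M F 1) {x₀ : M} {y : E}
    (hy : y ∈ (extChartAt 𝓘(ℝ, E) x₀).target) :
    (α.compJ).inChart x₀ y = (α.inChart x₀ y).compContinuousLinearMap
      ((Complex.I • ContinuousLinearMap.id ℂ E).restrictScalars ℝ) := by
  rw [MForm.inChart_eq_of_mem_target _ hy, MForm.inChart_eq_of_mem_target _ hy]
  set z := (extChartAt 𝓘(ℝ, E) x₀).symm y with hz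
  have hzs : z ∈ (extChartAt 𝓘(ℝ, E) x₀).source ∩ (extChartAt 𝓘(ℝ, E) z).source :=
    ⟨(extChartAt 𝓘(ℝ, E) x₀).map_target hy, mem_extChartAt_source z⟩
  have hJ : ∀ w : E,
      ((Complex.I • ContinuousLinearMap.id ℂ E).restrictScalars ℝ) w = Complex.I • w :=
    fun _ ↦ rfl
  ext v
  simp only [ContinuousAlternatingMap.compContinuousLinearMap_apply, MForm.compJ_apply,
    Function.comp_def, hJ]
  congr 1
  funext i
  rw [tangentJ_apply]
  exact (tangentCoordChange_I_smul hzs (v i)).symm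

/-- **`α ∘ J` is smooth where `α` is** (its chart representative is that of `α` composed with the
constant linear map `i • ·`). [folklore] -/
theorem MForm.SmoothAt.compJ {α : MForm 𝓘(ℝ, E) M F 1} {x : M} (hα : α.SmoothAt x) :
    α.compJ.SmoothAt x := by
  have hev : (α.compJ).inChart x =ᶠ[𝓝[range 𝓘(ℝ, E)] (extChartAt 𝓘(ℝ, E) x x)]
      fun y ↦ (α.inChart x y).compContinuousLinearMap
        ((Complex.I • ContinuousLinearMap.id ℂ E).restrictScalars ℝ) := by
    filter_upwards [extChartAt_target_mem_nhdsWithin x] with y hy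
    exact α.inChart_compJ_of_mem_target hy
  have hsm : ContDiffWithinAt ℝ ∞ (fun y ↦ (α.inChart x y).compContinuousLinearMap
      ((Complex.I • ContinuousLinearMap.id ℂ E).restrictScalars ℝ)) (range 𝓘(ℝ, E))
      (extChartAt 𝓘(ℝ, E) x x) :=
    Literature.NumberTheory.Transcendental.ContDiffWithinAt.continuousAlternatingMapCompContinuousLinearMap
      hα contDiffWithinAt_const
  exact hsm.congr_of_eventuallyEq hev (α.inChart_compJ_of_mem_target (mem_extChartAt_target x))

/-- Germ form of `MForm.SmoothAt.compJ`. [folklore] -/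
theorem MForm.eventually_smoothAt_compJ {α : MForm 𝓘(ℝ, E) M F 1} {x : M}
    (hα : ∀ᶠ z in 𝓝 x, α.SmoothAt z) : ∀ᶠ z in 𝓝 x, α.compJ.SmoothAt z :=
  hα.mono fun _ h ↦ h.compJ

end ComplexStructure

/-! ### Pluriharmonicity of `log ‖g‖²` for `g` holomorphic and non-vanishing -/

section Pluriharmonic

variable {E : Type*} [NormedAddCommGroup E] [NormedSpace ℂ E]

/-- **The flat Cauchy–Riemann computation.** For `G` complex differentiable at `y₀` with
(`ℂ`-linear) derivative `D`, the real differentials of `2 Re G + L` and `-2 Im G` satisfy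
`d(2 Re G + L)(i v) = 2 Re (D (i v)) = 2 Re (i D v) = -2 Im (D v) = d(-2 Im G)(v)`. [folklore] -/
theorem fderiv_two_mul_re_apply_I_smul {G : E → ℂ} {y₀ : E} (hG : DifferentiableAt ℂ G y₀)
    (L : ℝ) (v : E) :
    fderiv ℝ (fun y ↦ ((2 * (G y).re + L : ℝ) : ℂ)) y₀ (Complex.I • v) =
      fderiv ℝ (fun y ↦ ((-2 * (G y).im : ℝ) : ℂ)) y₀ v := by
  set D : E →L[ℂ] ℂ := fderiv ℂ G y₀ with hD_def
  have hD : HasFDerivAt G (D.restrictScalars ℝ) y₀ := hG.hasFDerivAt.restrictScalars ℝ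
  have h1 : HasFDerivAt (fun y ↦ ((2 * (G y).re + L : ℝ) : ℂ))
      (Complex.ofRealCLM.comp ((2 : ℝ) • Complex.reCLM.comp (D.restrictScalars ℝ))) y₀ :=
    Complex.ofRealCLM.hasFDerivAt.comp y₀
      (((Complex.reCLM.hasFDerivAt.comp y₀ hD).const_mul (2 : ℝ)).add_const L)
  have h2 : HasFDerivAt (fun y ↦ ((-2 * (G y).im : ℝ) : ℂ))
      (Complex.ofRealCLM.comp ((-2 : ℝ) • Complex.imCLM.comp (D.restrictScalars ℝ))) y₀ :=
    Complex.ofRealCLM.hasFDerivAt.comp y₀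
      ((Complex.imCLM.hasFDerivAt.comp y₀ hD).const_mul (-2 : ℝ))
  rw [h1.fderiv, h2.fderiv]
  change (((2 : ℝ) * (D (Complex.I • v)).re : ℝ) : ℂ) = (((-2 : ℝ) * (D v).im : ℝ) : ℂ)
  rw [D.map_smul, smul_eq_mul, Complex.I_mul_re]
  push_cast
  ring

variable {M : Type*} [TopologicalSpace M] [ChartedSpace E M]

/-- A holomorphic function read in the chart at a point (the same partial equivalence for
`𝓘(ℂ, E)` and for `𝓘(ℝ, E)`) is complex differentiable at the centre. [folklore] -/
theorem differentiableAt_comp_extChartAt_symm_of_mdifferentiableAt {F : Type*}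
    [NormedAddCommGroup F] [NormedSpace ℂ F] {g : M → F} {z : M}
    (hg : MDifferentiableAt 𝓘(ℂ, E) 𝓘(ℂ, F) g z) :
    DifferentiableAt ℂ (g ∘ (extChartAt 𝓘(ℝ, E) z).symm) (extChartAt 𝓘(ℝ, E) z z) := by
  have h := hg.differentiableWithinAt_writtenInExtChartAt
  simp only [writtenInExtChartAt, extChartAt_model_space_eq_id, PartialEquiv.refl_coe,
    Function.id_comp, ModelWithCorners.Boundaryless.range_eq_univ,
    differentiableWithinAt_univ] at h
  exact h

/-- `log ‖g‖²` of a real-`C^∞` complex function is real `C^∞` where `g ≠ 0`. [folklore] -/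
theorem contMDiffAt_ofReal_log_norm_sq {g : M → ℂ} {z : M}
    (hg : ContMDiffAt 𝓘(ℝ, E) 𝓘(ℝ, ℂ) ∞ g z) (h0 : g z ≠ 0) :
    ContMDiffAt 𝓘(ℝ, E) 𝓘(ℝ, ℂ) ∞ (fun z ↦ (Real.log (‖g z‖ ^ 2) : ℂ)) z := by
  have h1 : ContDiffAt ℝ ∞ (fun u : ℂ ↦ Real.log (‖u‖ ^ 2)) (g z) :=
    ((contDiff_norm_sq ℝ (E := ℂ)).contDiffAt).log (pow_ne_zero 2 (norm_ne_zero_iff.2 h0))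
  have h2 : ContDiffAt ℝ ∞ (fun u : ℂ ↦ (Real.log (‖u‖ ^ 2) : ℂ)) (g z) :=
    Complex.ofRealCLM.contDiff.contDiffAt.comp _ h1
  exact h2.comp_contMDiffAt hg

/-- **`log ‖g‖²` is pluriharmonic for `g` holomorphic and non-vanishing.** For `g` holomorphic
and nowhere zero on an open subset `V` of the complex manifold `M` (finite-dimensional model `E`),
the `2`-form `d((d log ‖g‖²) ∘ J)` (`= -dd^c log ‖g‖² = -2i ∂∂̄ log ‖g‖²`) vanishes at every point
`x ∈ V`: near `x`, `log ‖g‖² = 2 Re G + log ‖g x‖²` with `G = log (g / g x)` holomorphic, and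
`(d(2 Re G)) ∘ J = d(-2 Im G)` (Cauchy–Riemann, `fderiv_two_mul_re_apply_I_smul` in the chart at
each nearby point), so the form is `dd(-2 Im G) = 0` (`mextDeriv_mextDeriv_of_smoothAt`).
Voisin (2002), §3.3.1: "`∂∂̄ log |g_ij|² = 0`" for the holomorphic invertible `g_ij`.
[cite: VoisinHodgeI2002, §3.3.1] -/
theorem mextDeriv_compJ_mextDeriv_log_norm_sq_eq_zero [FiniteDimensional ℂ E]
    [IsManifold 𝓘(ℝ, E) ∞ M] [IsManifold 𝓘(ℂ, E) ω M] {g : M → ℂ} {V : Set M}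
    (hg : MDifferentiableOn 𝓘(ℂ, E) 𝓘(ℂ, ℂ) g V) (hV : IsOpen V) (hg0 : ∀ z ∈ V, g z ≠ 0)
    {x : M} (hx : x ∈ V) :
    mextDeriv (mextDeriv (MForm.ofFun 𝓘(ℝ, E) fun z ↦ (Real.log (‖g z‖ ^ 2) : ℂ))).compJ x
      = 0 := by
  set c : ℂ := g x with hc_def
  have hc : c ≠ 0 := hg0 x hx
  -- the local holomorphic logarithm `G = log (g / c)` on the open neighbourhood `V'` of `x`
  set G : M → ℂ := fun z ↦ Complex.log (c⁻¹ * g z) with hG_def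
  set V' : Set M := V ∩ (fun z ↦ c⁻¹ * g z) ⁻¹' Complex.slitPlane with hV'_def
  have hcg_cont : ContinuousOn (fun z ↦ c⁻¹ * g z) V := continuousOn_const.mul hg.continuousOn
  have hV'o : IsOpen V' := hcg_cont.isOpen_inter_preimage hV Complex.isOpen_slitPlane
  have hxV' : x ∈ V' := by
    refine ⟨hx, ?_⟩
    show c⁻¹ * g x ∈ Complex.slitPlane
    rw [← hc_def, inv_mul_cancel₀ hc]
    exact Complex.one_mem_slitPlane
  have hmul : Differentiable ℂ (fun u : ℂ ↦ c⁻¹ * u) := differentiable_id.const_mul c⁻¹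
  have hcg : MDifferentiableOn 𝓘(ℂ, E) 𝓘(ℂ, ℂ) (fun z ↦ c⁻¹ * g z) V := fun z hz ↦
    (hmul (g z)).comp_mdifferentiableWithinAt (hg z hz)
  have hGd : MDifferentiableOn 𝓘(ℂ, E) 𝓘(ℂ, ℂ) G V' := fun z hz ↦ by
    have h1 : MDifferentiableWithinAt 𝓘(ℂ, E) 𝓘(ℂ, ℂ) (fun z ↦ c⁻¹ * g z) V' z :=
      (hcg z hz.1).mono inter_subset_left
    have h2 : DifferentiableAt ℂ Complex.log (c⁻¹ * g z) := Complex.differentiableAt_log hz.2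
    exact h2.comp_mdifferentiableWithinAt (f := fun z ↦ c⁻¹ * g z) (x := z) h1
  have hGs : ∀ z ∈ V', ContMDiffAt 𝓘(ℝ, E) 𝓘(ℝ, ℂ) ∞ G z := fun z hz ↦
    contMDiffAt_real_of_mdifferentiableOn_complex hGd hV'o hz
  -- `log ‖g‖² = 2 Re G + log ‖c‖²` on `V'`
  have hlog : ∀ z ∈ V', (Real.log (‖g z‖ ^ 2) : ℂ) =
      ((2 * (G z).re + Real.log (‖c‖ ^ 2) : ℝ) : ℂ) := by
    intro z hz
    have hcn : ‖c‖ ≠ 0 := norm_ne_zero_iff.2 hc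
    have hgn : ‖g z‖ ≠ 0 := norm_ne_zero_iff.2 (hg0 z hz.1)
    congr 1
    simp only [hG_def, Complex.log_re, norm_mul, norm_inv]
    rw [Real.log_mul (inv_ne_zero hcn) hgn, Real.log_inv, Real.log_pow, Real.log_pow]
    push_cast
    ring
  -- the primitive `m = -2 Im G` of `(d log ‖g‖²) ∘ J` on `V'`
  set m : M → ℂ := fun z ↦ ((-2 * (G z).im : ℝ) : ℂ) with hm_def
  have hpt : ∀ z ∈ V',
      (mextDeriv (MForm.ofFun 𝓘(ℝ, E) fun z ↦ (Real.log (‖g z‖ ^ 2) : ℂ))).compJ z =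
        mextDeriv (MForm.ofFun 𝓘(ℝ, E) m) z := by
    intro z hz
    have hGc : DifferentiableAt ℂ (G ∘ (extChartAt 𝓘(ℝ, E) z).symm) (extChartAt 𝓘(ℝ, E) z z) :=
      differentiableAt_comp_extChartAt_symm_of_mdifferentiableAt
        ((hGd z hz).mdifferentiableAt (hV'o.mem_nhds hz))
    have hev : ((fun z ↦ (Real.log (‖g z‖ ^ 2) : ℂ)) ∘ (extChartAt 𝓘(ℝ, E) z).symm)
        =ᶠ[𝓝 (extChartAt 𝓘(ℝ, E) z z)]
        fun y ↦ ((2 * ((G ∘ (extChartAt 𝓘(ℝ, E) z).symm) y).re + Real.log (‖c‖ ^ 2) : ℝ) : ℂ) := by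
      have h1 : ∀ᶠ y in 𝓝 (extChartAt 𝓘(ℝ, E) z z), (extChartAt 𝓘(ℝ, E) z).symm y ∈ V' := by
        refine (continuousAt_extChartAt_symm z).eventually ?_
        rw [extChartAt_to_inv]
        exact hV'o.mem_nhds hz
      filter_upwards [h1] with y hy
      exact hlog _ hy
    ext v
    rw [MForm.compJ_apply, mextDeriv_ofFun_apply, mextDeriv_ofFun_apply]
    simp only [ModelWithCorners.Boundaryless.range_eq_univ, fderivWithin_univ, tangentJ_apply]
    rw [hev.fderiv_eq]
    exact fderiv_two_mul_re_apply_I_smul hGc _ _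
  -- conclusion: `d((d log ‖g‖²) ∘ J) = dd m = 0` at `x`
  rw [mextDeriv_congr_of_eventuallyEq (Filter.eventually_of_mem (hV'o.mem_nhds hxV') hpt)]
  refine mextDeriv_mextDeriv_of_smoothAt ?_
  filter_upwards [hV'o.mem_nhds hxV'] with z hz
  refine MForm.smoothAt_ofFun_of_contMDiffAt ?_
  have hout : ContDiff ℝ ∞ (fun u : ℂ ↦ ((-2 * u.im : ℝ) : ℂ)) :=
    Complex.ofRealCLM.contDiff.comp (contDiff_const.mul Complex.imCLM.contDiff)
  exact hout.comp_contMDiffAt (hGs z hz)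

end Pluriharmonic

end Literature.Geometry.Kaehler
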